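import Summits.QuantumFields.YangMills.Theorems.FluctuationComparisonRegPrIntLS2BetaSeamSectorNormalForm
import Summits.QuantumFields.YangMills.Theorems.FluctuationComparisonRegPrIntLS2BetaCriticalOrbitUniqueOfExab
import Literature.MathematicalPhysics.QuantumFieldTheory.Balaban1983to89.T4SmallFieldWindowSandwich
import HarnessLib

/-!
# (RG-K) THE ℤ₂ SEAM TWIST, VI — AT EVERY CASE-B WINDOW DATUM, EVERY R2-CRITICAL MEMBER OF PRINT'S REGULAR SPACE (6)(ε₀) LIES ON THE
# RESIDUAL ORBIT OF THE FLAT REPRESENTATIVE; hence TUBE♭ ∕ GAP♭ OUTRIGHT AT `(V, U₀)` FOR EVERY CRITICAL (in particular every minimising) `U₀`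

Helper for crux `stmt-QuantumFields-20520` (`Theses.UnitScaleTilt.FluctuationComparisonRegPrIntL`), the (T)-chain of LINE
`semiclassical_s2beta` (cell `ym3-torus`, width seat «width 16» px16 g18).  Part V (✓`…S2BetaSeamSectorNormalForm`) put TUBE♭ ∕ GAP♭ at every
case-B datum `V = g • ζ_l^J` with the FLAT base point `(liftTransfTo g) • ζ_l^K`; the (T)-chain's letters are keyed on `(V, U₀)` with `U₀` a
minimiser ∕ R2-critical point of print's problem (5)–(6) over `V`.  THIS file moves the base point: by ✓px12 `atMostOneCriticalOrbit_of_loopHol_central`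
([Balaban1985Variational] Prop. 7 clause 1 at case-B data, unconditional) every R2-critical `U₀ ∈ (6)(ε₀)` over `V` is `u • ((liftTransfTo g) • ζ_l^K)`
with `u↓ = 1`, and ✓(B1) `tubeGrowthAt_gaugeAct_iff` ∕ `gapFlatAt_gaugeAct_iff` carry the letters along `u` (datum `u↓ • V = V`).

* §1 ★ `seamSectorRep_mem_regFibrePr` ∕ `seamSectorRep_isMinOn` ∕ `seamSectorRep_isCritR2` — the flat representative is a member of
  (6)(ε₀) over `g • ζ_l^J` (lit ✓`gaugeAct_mem_regFibrePr_iff`, ✓`regPr_of_flat`), a minimiser there (action `0`, lit ✓`wilsonAction4_nonneg`) and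
  R2-critical (lit ✓`isCritR2_of_isMinOn`).
* §2 ★★★ `exists_residual_eq_gaugeAct_seamSectorRep` — case B, `PlaqSmall δ V`, `δ ≤ 2`, `0 < ε₀`: every R2-critical `U₀ ∈ regFibrePr ε₀ V` is
  `u • ((liftTransfTo g) • ζ_l^K)` with `descTransf u = 1`, where `V = g • ζ_l^J` (✓part V ∘ ✓px12 Prop. 7 cl. 1 case B).
* §3 ★★★★ `exists_tubeGrowth_caseB_atCritical` ∕ ★★★★ `exists_gapFlat_caseB_atCritical` — TUBE♭ ∕ GAP♭ OUTRIGHT at `(V, U₀)` for EVERY case-B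
  `2`-small window datum `V` and EVERY R2-critical `U₀ ∈ regFibrePr ε₀ V` (✓p799103's bodies with `(1,1) ↦ (V, U₀)`; same `γ₁`, same `μ`; NO letter,
  any `L`).
* §4 `isCritR2_of_eq_minActionRegPr`; ★★★★ `exists_tubeGrowth_caseB_atMin` ∕ ★★★★ `exists_gapFlat_caseB_atMin` — the same keyed on the chain's
  minimiser binder `U₀ ∈ regFibrePr ε₀ V`, `A(U₀) = minActionRegPr ε₀ V`.

HONEST: composition of landed letters (parts IV–V, ✓(B1), ✓px12 FILE 4) and the tree's carrier dictionary; nothing of Bałaban's analysis; case A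
(abelian, non-central holonomy) and the irreducible stratum are NOT touched here (✓px12 ∕ ✓px17 ∕ ✓px21 roads, thresholded); this file proves NO
stub of the line — TUBE-REG∘ (K-uniform `μ`, universal `δ`), GAP♯∘, EXW∘, S2β and crux 20520 stay OPEN; rung R3 (YM₃ on T³) is NOT d = 4, NOT
infinite volume, NOT a mass gap, NOT Clay; the Yang–Mills mass gap is NOT proved.
-/

set_option autoImplicit false

noncomputable section

open Set Function
open scoped Matrix.Norms.L2Operator
open Literature.MathematicalPhysics.QuantumFieldTheory.Balaban1983to89
open Literature.MathematicalPhysics.QuantumFieldTheory.Balaban1983to89.T4Continuum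
open Literature.MathematicalPhysics.QuantumFieldTheory.Balaban1983to89.T3ContinuumYM3Torus
open Literature.MathematicalPhysics.QuantumFieldTheory.Balaban1983to89.T3UnitLawDensityEML (ℰp)
open Literature.MathematicalPhysics.QuantumFieldTheory.Balaban1983to89.T3UnitScaleTilt
open Literature.MathematicalPhysics.QuantumFieldTheory.Balaban1983to89.T3TiltDescent
open Literature.MathematicalPhysics.QuantumFieldTheory.Balaban1983to89.T3ConstrainedMinimiser (fibre)
open Literature.MathematicalPhysics.QuantumFieldTheory.Balaban1983to89.T3PrintedRegularMinimiser
open Literature.MathematicalPhysics.QuantumFieldTheory.Balaban1983to89.T3PrintedRegularOrbits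
open scoped Literature.MathematicalPhysics.QuantumFieldTheory.Balaban1983to89.T3OrbitAverage
open Literature.MathematicalPhysics.QuantumFieldTheory.Balaban1983to89.ExpMeanLog (deltaSU)
open Literature.MathematicalPhysics.QuantumFieldTheory.Balaban1983to89.T4SmallFieldWindowSandwich (gaugeAct_const_one)
open Literature.MathematicalPhysics.QuantumFieldTheory.Balaban1983to89.T3Thm1Carrier (varProblem3)
open Literature.MathematicalPhysics.QuantumFieldTheory.Balaban1983to89.T3Thm1CarrierNative (IsCritR2 isCritR2_of_isMinOn)
open Summit.QuantumFields.YangMills.Theorems.FluctuationComparisonRegPrIntLS2BetaResidualGauge (wilsonAction4_gaugeAct)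
open Summit.QuantumFields.YangMills.Theorems.FluctuationComparisonRegPrIntLRegArgminFlat (regPr_of_flat)
open Summit.QuantumFields.YangMills.Theorems.FluctuationComparisonRegPrIntLS2BetaCriticalOrbitUnique (negOne_mul_comm negOne_mul_negOne)
open Summit.QuantumFields.YangMills.Theorems.BrascampLiebVacuumSC.DimensionGapSU2 (neg_one_mem)
open Summit.QuantumFields.YangMills.Theorems.FluctuationComparisonRegPrIntLS2BetaTubeLettersOrbitTransport (tubeGrowthAt_gaugeAct_iff gapFlatAt_gaugeAct_iff)
open Summit.QuantumFields.YangMills.Theorems.FluctuationComparisonRegPrIntLS2BetaTubeLettersSeamSectors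
open Summit.QuantumFields.YangMills.Theorems.FluctuationComparisonRegPrIntLS2BetaSeamSectorNormalForm (exists_gauge_seamFold_of_loopHol_central)
open Summit.QuantumFields.YangMills.Theorems.FluctuationComparisonRegPrIntLS2BetaCriticalOrbitUniqueOfExab (atMostOneCriticalOrbit_of_loopHol_central)

namespace Summit.QuantumFields.YangMills.Theorems.FluctuationComparisonRegPrIntLS2BetaSeamSectorMinimisers

variable (F : T3Family) {J K : ℕ}

/-! ## §1 The flat representative is an R2-critical member of (6)(ε₀) over the sector datum -/

/-- ★ **The flat representative `(liftTransfTo g) • ζ_l^K` is a member of print's regular space (6)(ε₀) over `g • ζ_l^J`** (`ε₀ > 0`).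
[cite: Balaban1985Variational, (5)-(6) p.278] -/
theorem seamSectorRep_mem_regFibrePr (hJK : J ≤ K) {ε₀ : ℝ} (hε₀ : 0 < ε₀)
    (g : GaugeTransf (F.P J) 0 (Matrix.specialUnitaryGroup (Fin 2) ℂ)) (l : List (Fin 3)) :
    (GaugeField.gaugeAct (liftTransfTo F J K hJK g) (l.foldr (fun (ν : Fin 3) (X : GaugeField (F.P K) 0 (Matrix.specialUnitaryGroup (Fin 2) ℂ)) => fun b : PBond (F.P K) 0 =>
            (if b.dir = ν ∧ (b.src ν).val + 1 = (F.P K).sitesPerDir 0 then (⟨-1, neg_one_mem⟩ : Matrix.specialUnitaryGroup (Fin 2) ℂ) else 1) * X b) (1 : GaugeField (F.P K) 0 (Matrix.specialUnitaryGroup (Fin 2) ℂ)))) ∈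
      regFibrePr F J K hJK ε₀ (GaugeField.gaugeAct g (l.foldr (fun (ν : Fin 3) (X : GaugeField (F.P J) 0 (Matrix.specialUnitaryGroup (Fin 2) ℂ)) => fun c : PBond (F.P J) 0 =>
            (if c.dir = ν ∧ (c.src ν).val + 1 = (F.P J).sitesPerDir 0 then (⟨-1, neg_one_mem⟩ : Matrix.specialUnitaryGroup (Fin 2) ℂ) else 1) * X c) (1 : GaugeField (F.P J) 0 (Matrix.specialUnitaryGroup (Fin 2) ℂ)))) := by
  have h1 : (l.foldr (fun (ν : Fin 3) (X : GaugeField (F.P K) 0 (Matrix.specialUnitaryGroup (Fin 2) ℂ)) => fun b : PBond (F.P K) 0 =>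
            (if b.dir = ν ∧ (b.src ν).val + 1 = (F.P K).sitesPerDir 0 then (⟨-1, neg_one_mem⟩ : Matrix.specialUnitaryGroup (Fin 2) ℂ) else 1) * X b) (1 : GaugeField (F.P K) 0 (Matrix.specialUnitaryGroup (Fin 2) ℂ))) ∈
      regFibrePr F J K hJK ε₀ (l.foldr (fun (ν : Fin 3) (X : GaugeField (F.P J) 0 (Matrix.specialUnitaryGroup (Fin 2) ℂ)) => fun c : PBond (F.P J) 0 =>
            (if c.dir = ν ∧ (c.src ν).val + 1 = (F.P J).sitesPerDir 0 then (⟨-1, neg_one_mem⟩ : Matrix.specialUnitaryGroup (Fin 2) ℂ) else 1) * X c) (1 : GaugeField (F.P J) 0 (Matrix.specialUnitaryGroup (Fin 2) ℂ))) :=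
    (mem_regFibrePr_iff F).2 ⟨descendTo_seamFold_one F hJK l, regPr_of_flat F hε₀ (plaqHol_seamFold_one F l)⟩
  have h2 := (gaugeAct_mem_regFibrePr_iff F hJK hε₀.le (liftTransfTo F J K hJK g) _ _).2 h1
  rwa [descTransf_liftTransfTo] at h2

/-- ★ **… and a minimiser of the Wilson action there** (its action is `0`). [cite: Balaban1985Variational, (5) p.278] -/
theorem seamSectorRep_isMinOn (hJK : J ≤ K) (ε₀ : ℝ) (g : GaugeTransf (F.P J) 0 (Matrix.specialUnitaryGroup (Fin 2) ℂ)) (l : List (Fin 3)) :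
    IsMinOn (fun W : GaugeField (F.P K) 0 (Matrix.specialUnitaryGroup (Fin 2) ℂ) => wilsonAction4 W)
      (regFibrePr F J K hJK ε₀ (GaugeField.gaugeAct g (l.foldr (fun (ν : Fin 3) (X : GaugeField (F.P J) 0 (Matrix.specialUnitaryGroup (Fin 2) ℂ)) => fun c : PBond (F.P J) 0 =>
            (if c.dir = ν ∧ (c.src ν).val + 1 = (F.P J).sitesPerDir 0 then (⟨-1, neg_one_mem⟩ : Matrix.specialUnitaryGroup (Fin 2) ℂ) else 1) * X c) (1 : GaugeField (F.P J) 0 (Matrix.specialUnitaryGroup (Fin 2) ℂ)))))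
      (GaugeField.gaugeAct (liftTransfTo F J K hJK g) (l.foldr (fun (ν : Fin 3) (X : GaugeField (F.P K) 0 (Matrix.specialUnitaryGroup (Fin 2) ℂ)) => fun b : PBond (F.P K) 0 =>
            (if b.dir = ν ∧ (b.src ν).val + 1 = (F.P K).sitesPerDir 0 then (⟨-1, neg_one_mem⟩ : Matrix.specialUnitaryGroup (Fin 2) ℂ) else 1) * X b) (1 : GaugeField (F.P K) 0 (Matrix.specialUnitaryGroup (Fin 2) ℂ)))) := by
  intro W _
  show wilsonAction4 (GaugeField.gaugeAct (liftTransfTo F J K hJK g) (l.foldr (fun (ν : Fin 3) (X : GaugeField (F.P K) 0 (Matrix.specialUnitaryGroup (Fin 2) ℂ)) => fun b : PBond (F.P K) 0 =>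
            (if b.dir = ν ∧ (b.src ν).val + 1 = (F.P K).sitesPerDir 0 then (⟨-1, neg_one_mem⟩ : Matrix.specialUnitaryGroup (Fin 2) ℂ) else 1) * X b) (1 : GaugeField (F.P K) 0 (Matrix.specialUnitaryGroup (Fin 2) ℂ)))) ≤ wilsonAction4 W
  rw [wilsonAction4_gaugeAct, wilsonAction4_seamFold_one]
  exact wilsonAction4_nonneg W

/-- ★ **… hence R2-critical** (lit ✓`isCritR2_of_isMinOn`). [cite: Balaban1985Variational, (6) p.278, Prop. 7 p.299] -/
theorem seamSectorRep_isCritR2 (hJK : J ≤ K) {ε₀ : ℝ} (hε₀ : 0 < ε₀)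
    (g : GaugeTransf (F.P J) 0 (Matrix.specialUnitaryGroup (Fin 2) ℂ)) (l : List (Fin 3)) :
    IsCritR2 F J K hJK (GaugeField.gaugeAct g (l.foldr (fun (ν : Fin 3) (X : GaugeField (F.P J) 0 (Matrix.specialUnitaryGroup (Fin 2) ℂ)) => fun c : PBond (F.P J) 0 =>
            (if c.dir = ν ∧ (c.src ν).val + 1 = (F.P J).sitesPerDir 0 then (⟨-1, neg_one_mem⟩ : Matrix.specialUnitaryGroup (Fin 2) ℂ) else 1) * X c) (1 : GaugeField (F.P J) 0 (Matrix.specialUnitaryGroup (Fin 2) ℂ))))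
      (GaugeField.gaugeAct (liftTransfTo F J K hJK g) (l.foldr (fun (ν : Fin 3) (X : GaugeField (F.P K) 0 (Matrix.specialUnitaryGroup (Fin 2) ℂ)) => fun b : PBond (F.P K) 0 =>
            (if b.dir = ν ∧ (b.src ν).val + 1 = (F.P K).sitesPerDir 0 then (⟨-1, neg_one_mem⟩ : Matrix.specialUnitaryGroup (Fin 2) ℂ) else 1) * X b) (1 : GaugeField (F.P K) 0 (Matrix.specialUnitaryGroup (Fin 2) ℂ)))) :=
  isCritR2_of_isMinOn hε₀ (seamSectorRep_mem_regFibrePr F hJK hε₀ g l) (seamSectorRep_isMinOn F hJK ε₀ g l)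

/-! ## §2 Case B: every R2-critical member lies on the residual orbit of the flat representative -/

/-- ★★★ **AT A CASE-B DATUM EVERY R2-CRITICAL MEMBER OF (6)(ε₀) IS A RESIDUAL-GAUGE TRANSFORM OF THE FLAT REPRESENTATIVE**: `V` with central
closed-walk holonomies and `PlaqSmall δ V`, `δ ≤ 2`; `0 < ε₀`; `U₀ ∈ regFibrePr ε₀ V` R2-critical ⟹ `V = g • ζ_l^J`, `U₀ = u • ((liftTransfTo g) • ζ_l^K)`,
`u↓ = 1` (✓`exists_gauge_seamFold_of_loopHol_central` ∘ ✓px12 `atMostOneCriticalOrbit_of_loopHol_central` ∘ §1). [cite: Balaban1985Variational, Prop. 7 p.299, (4)-(6) p.278] -/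
theorem exists_residual_eq_gaugeAct_seamSectorRep (hlt : J < K) {ε₀ : ℝ} (hε₀ : 0 < ε₀)
    (V : GaugeField (F.P J) 0 (Matrix.specialUnitaryGroup (Fin 2) ℂ)) (x₀ : Site (F.P J) 0)
    (hcen : ∀ w : List (Letter (F.P J).d), walkEnd x₀ w = x₀ →
      ∀ M : Matrix (Fin 2) (Fin 2) ℂ, Commute ((holAt V (walk x₀ w) : Matrix.specialUnitaryGroup (Fin 2) ℂ) : Matrix (Fin 2) (Fin 2) ℂ) M)
    {δ : ℝ} (hδ : δ ≤ 2) (hV : PlaqSmall δ V)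
    (U₀ : GaugeField (F.P K) 0 (Matrix.specialUnitaryGroup (Fin 2) ℂ)) (hU₀ : U₀ ∈ regFibrePr F J K hlt.le ε₀ V) (hcrit : IsCritR2 F J K hlt.le V U₀) :
    ∃ (g : GaugeTransf (F.P J) 0 (Matrix.specialUnitaryGroup (Fin 2) ℂ)) (l : List (Fin 3)) (u : GaugeTransf (F.P K) 0 (Matrix.specialUnitaryGroup (Fin 2) ℂ)),
      l.Nodup ∧ V = GaugeField.gaugeAct g (l.foldr (fun (ν : Fin 3) (X : GaugeField (F.P J) 0 (Matrix.specialUnitaryGroup (Fin 2) ℂ)) => fun c : PBond (F.P J) 0 =>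
            (if c.dir = ν ∧ (c.src ν).val + 1 = (F.P J).sitesPerDir 0 then (⟨-1, neg_one_mem⟩ : Matrix.specialUnitaryGroup (Fin 2) ℂ) else 1) * X c) (1 : GaugeField (F.P J) 0 (Matrix.specialUnitaryGroup (Fin 2) ℂ))) ∧
      descTransf F J K hlt.le u = (fun _ => 1) ∧
      U₀ = GaugeField.gaugeAct u (GaugeField.gaugeAct (liftTransfTo F J K hlt.le g) (l.foldr (fun (ν : Fin 3) (X : GaugeField (F.P K) 0 (Matrix.specialUnitaryGroup (Fin 2) ℂ)) => fun b : PBond (F.P K) 0 =>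
            (if b.dir = ν ∧ (b.src ν).val + 1 = (F.P K).sitesPerDir 0 then (⟨-1, neg_one_mem⟩ : Matrix.specialUnitaryGroup (Fin 2) ℂ) else 1) * X b) (1 : GaugeField (F.P K) 0 (Matrix.specialUnitaryGroup (Fin 2) ℂ)))) := by
  obtain ⟨g, l, hl, hVg⟩ := exists_gauge_seamFold_of_loopHol_central V x₀ hcen hδ hV
  have hVg' : V = GaugeField.gaugeAct g (l.foldr (fun (ν : Fin 3) (X : GaugeField (F.P J) 0 (Matrix.specialUnitaryGroup (Fin 2) ℂ)) => fun c : PBond (F.P J) 0 =>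
            (if c.dir = ν ∧ (c.src ν).val + 1 = (F.P J).sitesPerDir 0 then (⟨-1, neg_one_mem⟩ : Matrix.specialUnitaryGroup (Fin 2) ℂ) else 1) * X c) (1 : GaugeField (F.P J) 0 (Matrix.specialUnitaryGroup (Fin 2) ℂ))) := hVg
  have h1 := atMostOneCriticalOrbit_of_loopHol_central F hlt V x₀ hcen hδ hV ε₀
  have hZ := seamSectorRep_mem_regFibrePr F hlt.le hε₀ g l
  have hZc := seamSectorRep_isCritR2 F hlt.le hε₀ g l
  rw [← hVg'] at hZ hZc
  obtain ⟨u, hu, hU₀u⟩ := h1 _ U₀ ((mem_regFibrePr_iff F).1 hZ).2 ((mem_regFibrePr_iff F).1 hZ).1 hZc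
    ((mem_regFibrePr_iff F).1 hU₀).2 ((mem_regFibrePr_iff F).1 hU₀).1 hcrit
  exact ⟨g, l, u, hl, hVg', hu, hU₀u⟩

/-! ## §3 TUBE♭ ∕ GAP♭ OUTRIGHT at `(V, U₀)` for every case-B datum and every R2-critical base point -/

/-- ★★★★ **TUBE♭ OUTRIGHT AT `(V, U₀)` FOR EVERY CASE-B WINDOW DATUM `V` AND EVERY R2-CRITICAL `U₀ ∈ (6)(ε₀)` OVER IT** (every radius `δ'`; same
`γ₁(L, b₀, p₀)` and, per `(F, γ, J, K, ε₀, g, l, δ')`, the same `μ` as ✓px12 `exists_tubeGrowth_flat` at `(1,1)`).  NO letter, any `L`.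
[cite: Balaban1985Variational, (142) p.299, Prop. 7 p.299, Thm 1 (8) p.279; Balaban1985UV3, (12)-(13) p.259, (18)-(22) p.260] -/
theorem exists_tubeGrowth_caseB_atCritical (L : ℕ) (b₀ p₀ : ℝ) (hb : 0 < b₀) (hp : 0 < p₀) :
    ∃ γ₁ : ℝ, 0 < γ₁ ∧ ∀ (F : T3Family) (γ : ℝ), F.L = L → 0 < γ → γ ≤ γ₁ →
      ∀ (J K : ℕ) (hlt : J < K) (hk : K - J ≤ (F.P K).m + (F.P K).K)
        (ε₀ : ℝ), 0 < ε₀ → (143 * ((((3 + 4 : ℕ) : ℝ)) ^ 2 / 4) ^ 2) * (2 * ε₀) ≤ 1 / 3 →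
          2 * (2 * ε₀) ≤ 2 * deltaSU (Fin 2) / (((3 + 4) * F.L : ℕ) : ℝ) ^ 2 →
        ∀ (V : GaugeField (F.P J) 0 (Matrix.specialUnitaryGroup (Fin 2) ℂ)) (x₀ : Site (F.P J) 0),
          (∀ w : List (Letter (F.P J).d), walkEnd x₀ w = x₀ →
            ∀ M : Matrix (Fin 2) (Fin 2) ℂ, Commute ((holAt V (walk x₀ w) : Matrix.specialUnitaryGroup (Fin 2) ℂ) : Matrix (Fin 2) (Fin 2) ℂ) M) →
          ∀ δ : ℝ, δ ≤ 2 → PlaqSmall δ V →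
          ∀ U₀ : GaugeField (F.P K) 0 (Matrix.specialUnitaryGroup (Fin 2) ℂ), U₀ ∈ regFibrePr F J K hlt.le ε₀ V → IsCritR2 F J K hlt.le V U₀ →
          ∀ δ' : ℝ, ∃ μ : ℝ, 0 < μ ∧ ∀ U ∈ fibre F ℰp J K hlt.le V,
            U ∈ histGood F ℰp (θBal F.L γ b₀ p₀) K J →
          (∃ w : Site (F.P K) 0 → Matrix.specialUnitaryGroup (Fin 2) ℂ,
          (∀ U'' : GaugeField (F.P K) 0 (Matrix.specialUnitaryGroup (Fin 2) ℂ),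
          descendTo F ℰp J K hlt.le (GaugeField.gaugeAct w U'') = descendTo F ℰp J K hlt.le U'') ∧
          ∀ ℓ : PBond (F.P K) 0, dist1 (U ℓ * ((GaugeField.gaugeAct w
            U₀) ℓ)⁻¹) ≤ δ') →
          μ * ((F.L : ℝ)⁻¹) ^ (2 * (K - J)) *
          (⨅ w : {w : Site (F.P K) 0 → Matrix.specialUnitaryGroup (Fin 2) ℂ |
          ∀ U : GaugeField (F.P K) 0 (Matrix.specialUnitaryGroup (Fin 2) ℂ),
          descendTo F ℰp J K hlt.le (GaugeField.gaugeAct w U) = descendTo F ℰp J K hlt.le U},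
          ∑ ℓ : PBond (F.P K) 0,
          dist1 (U ℓ * ((GaugeField.gaugeAct (w : Site (F.P K) 0 → Matrix.specialUnitaryGroup (Fin 2) ℂ)
            U₀) ℓ)⁻¹) ^ 2)
          ≤ wilsonAction4 U - minActionRegPr F J K hlt.le ε₀ V := by
  obtain ⟨γ₁, hγ₁, hmain⟩ := exists_tubeGrowth_seamSector L b₀ p₀ hb hp
  refine ⟨γ₁, hγ₁, ?_⟩
  intro F γ hFL hγ hγle J K hlt hk ε₀ hε₀ hr3 hr2 V x₀ hcen δ hδ hV U₀ hU₀ hcrit δ'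
  obtain ⟨g, l, u, -, hVg, hu, hU₀u⟩ := exists_residual_eq_gaugeAct_seamSectorRep F hlt hε₀ V x₀ hcen hδ hV U₀ hU₀ hcrit
  obtain ⟨μ, hμ, htube⟩ := hmain F γ hFL hγ hγle J K hlt hk ε₀ hε₀ hr3 hr2 g l δ'
  refine ⟨μ, hμ, ?_⟩
  have h2 := (tubeGrowthAt_gaugeAct_iff F hlt.le u (γ := γ) (b₀ := b₀) (p₀ := p₀) hε₀.le _ _ δ' μ).2 htube
  rw [hu, gaugeAct_const_one, ← hVg, ← hU₀u] at h2
  exact h2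

/-- ★★★★ **GAP♭ OUTRIGHT AT `(V, U₀)` FOR EVERY CASE-B WINDOW DATUM AND EVERY R2-CRITICAL BASE POINT** (`γ ≤ γ₁(L, b₀, p₀, δ')`; same `γ₁`, same
`μ` as ✓px12 `exists_gapFlat_flat` at `(1,1)`).  NO letter, any `L`.
[cite: Balaban1985Variational, (142) p.299, Prop. 7 p.299, Thm 1 (8) p.279; Balaban1984PropagatorsII, (1.33); Balaban1985UV3, (12)-(13) p.259] -/
theorem exists_gapFlat_caseB_atCritical (L : ℕ) (b₀ p₀ : ℝ) (hb : 0 < b₀) (hp : 0 < p₀) (δ' : ℝ) (hδ' : 0 < δ') :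
    ∃ γ₁ : ℝ, 0 < γ₁ ∧ ∀ (F : T3Family) (γ : ℝ), F.L = L → 0 < γ → γ ≤ γ₁ →
      ∀ (J K : ℕ) (hlt : J < K) (hk : K - J ≤ (F.P K).m + (F.P K).K)
        (ε₀ : ℝ), 0 < ε₀ → (143 * ((((3 + 4 : ℕ) : ℝ)) ^ 2 / 4) ^ 2) * (2 * ε₀) ≤ 1 / 3 →
          2 * (2 * ε₀) ≤ 2 * deltaSU (Fin 2) / (((3 + 4) * F.L : ℕ) : ℝ) ^ 2 →
        ∀ (V : GaugeField (F.P J) 0 (Matrix.specialUnitaryGroup (Fin 2) ℂ)) (x₀ : Site (F.P J) 0),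
          (∀ w : List (Letter (F.P J).d), walkEnd x₀ w = x₀ →
            ∀ M : Matrix (Fin 2) (Fin 2) ℂ, Commute ((holAt V (walk x₀ w) : Matrix.specialUnitaryGroup (Fin 2) ℂ) : Matrix (Fin 2) (Fin 2) ℂ) M) →
          ∀ δ : ℝ, δ ≤ 2 → PlaqSmall δ V →
          ∀ U₀ : GaugeField (F.P K) 0 (Matrix.specialUnitaryGroup (Fin 2) ℂ), U₀ ∈ regFibrePr F J K hlt.le ε₀ V → IsCritR2 F J K hlt.le V U₀ →
          ∃ μ : ℝ, 0 < μ ∧ ∀ U ∈ fibre F ℰp J K hlt.le V,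
          U ∈ histGood F ℰp (θBal F.L γ b₀ p₀) K J →
        μ * ((F.L : ℝ)⁻¹) ^ (2 * (K - J)) *
        (⨅ w : {w : Site (F.P K) 0 → Matrix.specialUnitaryGroup (Fin 2) ℂ |
        ∀ U : GaugeField (F.P K) 0 (Matrix.specialUnitaryGroup (Fin 2) ℂ),
        descendTo F ℰp J K hlt.le (GaugeField.gaugeAct w U) = descendTo F ℰp J K hlt.le U},
        ∑ ℓ : PBond (F.P K) 0,
        dist1 (U ℓ * ((GaugeField.gaugeAct (w : Site (F.P K) 0 → Matrix.specialUnitaryGroup (Fin 2) ℂ)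
          U₀) ℓ)⁻¹) ^ 2)
        ≤ wilsonAction4 U - minActionRegPr F J K hlt.le ε₀ V := by
  obtain ⟨γ₁, hγ₁, hmain⟩ := exists_gapFlat_seamSector L b₀ p₀ hb hp δ' hδ'
  refine ⟨γ₁, hγ₁, ?_⟩
  intro F γ hFL hγ hγle J K hlt hk ε₀ hε₀ hr3 hr2 V x₀ hcen δ hδ hV U₀ hU₀ hcrit
  obtain ⟨g, l, u, -, hVg, hu, hU₀u⟩ := exists_residual_eq_gaugeAct_seamSectorRep F hlt hε₀ V x₀ hcen hδ hV U₀ hU₀ hcrit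
  obtain ⟨μ, hμ, hgap⟩ := hmain F γ hFL hγ hγle J K hlt hk ε₀ hε₀ hr3 hr2 g l
  refine ⟨μ, hμ, ?_⟩
  have h2 := (gapFlatAt_gaugeAct_iff F hlt.le u (γ := γ) (b₀ := b₀) (p₀ := p₀) hε₀.le _ _ μ).2 hgap
  rw [hu, gaugeAct_const_one, ← hVg, ← hU₀u] at h2
  exact h2

/-! ## §4 The same at every MINIMISER base point (the chain's binder shape `A(U₀) = minActionRegPr ε₀ V`) -/

/-- A member of (6)(ε₀) whose action equals print's regular minimum is R2-critical (`ε₀ > 0`). [cite: Balaban1985Variational, (5)-(6) p.278, Prop. 7 p.299] -/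
theorem isCritR2_of_eq_minActionRegPr (hJK : J ≤ K) {ε₀ : ℝ} (hε₀ : 0 < ε₀)
    (V : GaugeField (F.P J) 0 (Matrix.specialUnitaryGroup (Fin 2) ℂ)) (U₀ : GaugeField (F.P K) 0 (Matrix.specialUnitaryGroup (Fin 2) ℂ))
    (hU₀ : U₀ ∈ regFibrePr F J K hJK ε₀ V) (hmin : wilsonAction4 U₀ = minActionRegPr F J K hJK ε₀ V) :
    IsCritR2 F J K hJK V U₀ :=
  isCritR2_of_isMinOn hε₀ hU₀ (fun W hW => by
    show wilsonAction4 U₀ ≤ wilsonAction4 W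
    rw [hmin]
    exact minActionRegPr_le F hW)

/-- ★★★★ **TUBE♭ OUTRIGHT AT `(V, U₀)` FOR EVERY CASE-B WINDOW DATUM `V` AND EVERY MINIMISER `U₀` OF PRINT'S REGULAR PROBLEM OVER IT**
(`U₀ ∈ regFibrePr ε₀ V`, `A(U₀) = minActionRegPr ε₀ V` — the (T)-chain's base-point binder; every radius `δ'`; same `γ₁`, same `μ`).  NO letter, any `L`.
[cite: Balaban1985Variational, (142) p.299, Prop. 7 p.299, Thm 1 (8) p.279; Balaban1985UV3, (12)-(13) p.259, (18)-(22) p.260] -/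
theorem exists_tubeGrowth_caseB_atMin (L : ℕ) (b₀ p₀ : ℝ) (hb : 0 < b₀) (hp : 0 < p₀) :
    ∃ γ₁ : ℝ, 0 < γ₁ ∧ ∀ (F : T3Family) (γ : ℝ), F.L = L → 0 < γ → γ ≤ γ₁ →
      ∀ (J K : ℕ) (hlt : J < K) (hk : K - J ≤ (F.P K).m + (F.P K).K)
        (ε₀ : ℝ), 0 < ε₀ → (143 * ((((3 + 4 : ℕ) : ℝ)) ^ 2 / 4) ^ 2) * (2 * ε₀) ≤ 1 / 3 →
          2 * (2 * ε₀) ≤ 2 * deltaSU (Fin 2) / (((3 + 4) * F.L : ℕ) : ℝ) ^ 2 →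
        ∀ (V : GaugeField (F.P J) 0 (Matrix.specialUnitaryGroup (Fin 2) ℂ)) (x₀ : Site (F.P J) 0),
          (∀ w : List (Letter (F.P J).d), walkEnd x₀ w = x₀ →
            ∀ M : Matrix (Fin 2) (Fin 2) ℂ, Commute ((holAt V (walk x₀ w) : Matrix.specialUnitaryGroup (Fin 2) ℂ) : Matrix (Fin 2) (Fin 2) ℂ) M) →
          ∀ δ : ℝ, δ ≤ 2 → PlaqSmall δ V →
          ∀ U₀ : GaugeField (F.P K) 0 (Matrix.specialUnitaryGroup (Fin 2) ℂ), U₀ ∈ regFibrePr F J K hlt.le ε₀ V →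
            wilsonAction4 U₀ = minActionRegPr F J K hlt.le ε₀ V →
          ∀ δ' : ℝ, ∃ μ : ℝ, 0 < μ ∧ ∀ U ∈ fibre F ℰp J K hlt.le V,
            U ∈ histGood F ℰp (θBal F.L γ b₀ p₀) K J →
          (∃ w : Site (F.P K) 0 → Matrix.specialUnitaryGroup (Fin 2) ℂ,
          (∀ U'' : GaugeField (F.P K) 0 (Matrix.specialUnitaryGroup (Fin 2) ℂ),
          descendTo F ℰp J K hlt.le (GaugeField.gaugeAct w U'') = descendTo F ℰp J K hlt.le U'') ∧
          ∀ ℓ : PBond (F.P K) 0, dist1 (U ℓ * ((GaugeField.gaugeAct w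
            U₀) ℓ)⁻¹) ≤ δ') →
          μ * ((F.L : ℝ)⁻¹) ^ (2 * (K - J)) *
          (⨅ w : {w : Site (F.P K) 0 → Matrix.specialUnitaryGroup (Fin 2) ℂ |
          ∀ U : GaugeField (F.P K) 0 (Matrix.specialUnitaryGroup (Fin 2) ℂ),
          descendTo F ℰp J K hlt.le (GaugeField.gaugeAct w U) = descendTo F ℰp J K hlt.le U},
          ∑ ℓ : PBond (F.P K) 0,
          dist1 (U ℓ * ((GaugeField.gaugeAct (w : Site (F.P K) 0 → Matrix.specialUnitaryGroup (Fin 2) ℂ)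
            U₀) ℓ)⁻¹) ^ 2)
          ≤ wilsonAction4 U - minActionRegPr F J K hlt.le ε₀ V := by
  obtain ⟨γ₁, hγ₁, hmain⟩ := exists_tubeGrowth_caseB_atCritical L b₀ p₀ hb hp
  refine ⟨γ₁, hγ₁, ?_⟩
  intro F γ hFL hγ hγle J K hlt hk ε₀ hε₀ hr3 hr2 V x₀ hcen δ hδ hV U₀ hU₀ hmin δ'
  exact hmain F γ hFL hγ hγle J K hlt hk ε₀ hε₀ hr3 hr2 V x₀ hcen δ hδ hV U₀ hU₀
    (isCritR2_of_eq_minActionRegPr F hlt.le hε₀ V U₀ hU₀ hmin) δ'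

/-- ★★★★ **GAP♭ OUTRIGHT AT `(V, U₀)` FOR EVERY CASE-B WINDOW DATUM AND EVERY MINIMISER BASE POINT** (`γ ≤ γ₁(L, b₀, p₀, δ')`; same `γ₁`, same `μ`).
NO letter, any `L`. [cite: Balaban1985Variational, (142) p.299, Prop. 7 p.299, Thm 1 (8) p.279; Balaban1984PropagatorsII, (1.33); Balaban1985UV3, (12)-(13) p.259] -/
theorem exists_gapFlat_caseB_atMin (L : ℕ) (b₀ p₀ : ℝ) (hb : 0 < b₀) (hp : 0 < p₀) (δ' : ℝ) (hδ' : 0 < δ') :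
    ∃ γ₁ : ℝ, 0 < γ₁ ∧ ∀ (F : T3Family) (γ : ℝ), F.L = L → 0 < γ → γ ≤ γ₁ →
      ∀ (J K : ℕ) (hlt : J < K) (hk : K - J ≤ (F.P K).m + (F.P K).K)
        (ε₀ : ℝ), 0 < ε₀ → (143 * ((((3 + 4 : ℕ) : ℝ)) ^ 2 / 4) ^ 2) * (2 * ε₀) ≤ 1 / 3 →
          2 * (2 * ε₀) ≤ 2 * deltaSU (Fin 2) / (((3 + 4) * F.L : ℕ) : ℝ) ^ 2 →
        ∀ (V : GaugeField (F.P J) 0 (Matrix.specialUnitaryGroup (Fin 2) ℂ)) (x₀ : Site (F.P J) 0),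
          (∀ w : List (Letter (F.P J).d), walkEnd x₀ w = x₀ →
            ∀ M : Matrix (Fin 2) (Fin 2) ℂ, Commute ((holAt V (walk x₀ w) : Matrix.specialUnitaryGroup (Fin 2) ℂ) : Matrix (Fin 2) (Fin 2) ℂ) M) →
          ∀ δ : ℝ, δ ≤ 2 → PlaqSmall δ V →
          ∀ U₀ : GaugeField (F.P K) 0 (Matrix.specialUnitaryGroup (Fin 2) ℂ), U₀ ∈ regFibrePr F J K hlt.le ε₀ V →
            wilsonAction4 U₀ = minActionRegPr F J K hlt.le ε₀ V →
          ∃ μ : ℝ, 0 < μ ∧ ∀ U ∈ fibre F ℰp J K hlt.le V,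
          U ∈ histGood F ℰp (θBal F.L γ b₀ p₀) K J →
        μ * ((F.L : ℝ)⁻¹) ^ (2 * (K - J)) *
        (⨅ w : {w : Site (F.P K) 0 → Matrix.specialUnitaryGroup (Fin 2) ℂ |
        ∀ U : GaugeField (F.P K) 0 (Matrix.specialUnitaryGroup (Fin 2) ℂ),
        descendTo F ℰp J K hlt.le (GaugeField.gaugeAct w U) = descendTo F ℰp J K hlt.le U},
        ∑ ℓ : PBond (F.P K) 0,
        dist1 (U ℓ * ((GaugeField.gaugeAct (w : Site (F.P K) 0 → Matrix.specialUnitaryGroup (Fin 2) ℂ)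
          U₀) ℓ)⁻¹) ^ 2)
        ≤ wilsonAction4 U - minActionRegPr F J K hlt.le ε₀ V := by
  obtain ⟨γ₁, hγ₁, hmain⟩ := exists_gapFlat_caseB_atCritical L b₀ p₀ hb hp δ' hδ'
  refine ⟨γ₁, hγ₁, ?_⟩
  intro F γ hFL hγ hγle J K hlt hk ε₀ hε₀ hr3 hr2 V x₀ hcen δ hδ hV U₀ hU₀ hmin
  exact hmain F γ hFL hγ hγle J K hlt hk ε₀ hε₀ hr3 hr2 V x₀ hcen δ hδ hV U₀ hU₀
    (isCritR2_of_eq_minActionRegPr F hlt.le hε₀ V U₀ hU₀ hmin)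

end Summit.QuantumFields.YangMills.Theorems.FluctuationComparisonRegPrIntLS2BetaSeamSectorMinimisers

end
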